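import Mathlib
import Literature.RingTheory.NoetherNormalization.HypersurfaceModel

/-!
# LangWeilTransfer, support item `TameResolution` (stmt-ValiantsHypothesis-6378) — the point
# condition of the Kronecker parametrisation

Route `LangWeilTransfer` of `ValiantsHypothesis` (conditional route; honest framing: bookkeeping,
nothing here bears on VP ≠ VNP). Step (C) of the architecture note of val-lit-p6 g9: once the
coordinates of the generic point satisfy `y_j · ρ(T̄) = V_j(T̄, u)` in the function field, and
`Q ∈ ℚ[T][U]` generates the kernel of the evaluation `ℚ[T][U] → F₀` at `(T̄, u)` (it is the
primitive minimal polynomial of the primitive element `u`), EVERY zero `x` of `Q` over any field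
with `ρ(x) ≠ 0` is carried by `V/ρ` into the zero set of the original equations:

* `eval_div_eq_zero_of_kernel` — for an equation `S` vanishing at the generic point, the weighted
  homogenisation `homog ρ V S` (tree `HypersurfaceModel.lean`) lies in the kernel, hence is a
  multiple of `Q`, hence vanishes at `x`, i.e. `S(V(x)/ρ(x)) = 0`.

The kernel hypothesis is discharged downstream by Gauss's lemma (Mathlib
`Polynomial.IsPrimitive.dvd_of_fraction_map_dvd_fraction_map`: `Q` primitive over the GCD domain
`ℚ[T]` and a constant multiple of the minimal polynomial of `u` over `ℚ(T)`).
-/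

noncomputable section

open MvPolynomial Polynomial
open Literature.RingTheory.NoetherNormalization

-- the summit and the problem share the name `ValiantsHypothesis` (D-0017 single-conjunct layout)
set_option linter.dupNamespace false

namespace Summit.ValiantsHypothesis.ValiantsHypothesis.Theorems.LangWeilTransfer

variable {K F₀ L : Type*} [Field K] [Field F₀] [Field L] {r m : ℕ}

/-- **The point condition.** Let `ψ : K[T][U] → F₀` be a ring homomorphism (evaluation at the
generic point `(T̄, u)`) with `ψ(ρ) ≠ 0`, whose kernel consists of multiples of `Q`; let
`y ∈ F₀^m` satisfy the graph relations `y_j · ψ(ρ) = ψ(V_j)` and let the equation `S ∈ K[Y]`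
vanish at `y`. Then for every homomorphism `χ : K[T][U] → L` to a field with `χ(Q) = 0` and
`χ(ρ) ≠ 0` (a zero of `Q` off `ρ = 0`), `S` vanishes at the point `(χ(V_j)/χ(ρ))_j`. -/
theorem eval_div_eq_zero_of_kernel
    (ρ : MvPolynomial (Fin r) K) (V : Fin m → (MvPolynomial (Fin r) K)[X]) (Q : (MvPolynomial (Fin r) K)[X])
    (S : MvPolynomial (Fin m) K)
    (ψ : (MvPolynomial (Fin r) K)[X] →+* F₀) (hρ : ψ (Polynomial.C ρ) ≠ 0)
    (hker : ∀ G : (MvPolynomial (Fin r) K)[X], ψ G = 0 → Q ∣ G)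
    (y : Fin m → F₀) (hy : ∀ j, y j * ψ (Polynomial.C ρ) = ψ (V j))
    (hS : MvPolynomial.eval y (MvPolynomial.map (ψ.comp (Polynomial.C.comp C)) S) = 0)
    (χ : (MvPolynomial (Fin r) K)[X] →+* L) (hχQ : χ Q = 0) (hχρ : χ (Polynomial.C ρ) ≠ 0) :
    MvPolynomial.eval (fun j => χ (V j) / χ (Polynomial.C ρ))
      (MvPolynomial.map (χ.comp (Polynomial.C.comp C)) S) = 0 := by
  -- the weighted homogenisation of `S` lies in the kernel of `ψ`
  have hG : ψ (homog ρ V S) = 0 := by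
    rw [map_homog_eq_of_mul_eq ψ ρ V S hρ y hy, hS, mul_zero]
  -- hence is a multiple of `Q`, hence killed by `χ`
  obtain ⟨H, hH⟩ := hker _ hG
  have hχG : χ (homog ρ V S) = 0 := by rw [hH, map_mul, hχQ, zero_mul]
  -- evaluation identity at `χ`
  rw [map_homog_eq χ ρ V S hχρ] at hχG
  exact (mul_eq_zero.1 hχG).resolve_left (pow_ne_zero _ hχρ)

end Summit.ValiantsHypothesis.ValiantsHypothesis.Theorems.LangWeilTransfer
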